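import Mathlib
import Summits.Ventures.PercRepro2.ZeroEdge
import Summits.Ventures.PercRepro2.StarHClass

/-!
# The three-coin faces of the hub: `a₃` adjacent only to one root, `o` and `b` (blind cell
PercRepro2, night-1 g13; NIGHT1-G13.md §1)

The hub class theorem `StarH.HMF_star_h` (a₃ adjacent exactly to `a₁`, `a₂`, `o`, `b`) yields its
faces by setting a missing coin to `0`: adjoin the missing root edge with weight `0` (`ZeroEdge`),
apply the hub theorem with that edge as the missing coin, and transport back (`HMF_ext_iff`).
Here the two classes of the single-vertex table that contain both `o` and `b` and ONE root:
(HMF), hence (HCOV), whenever `a₃` is adjacent only to `a₁`, `o`, `b` (`HMF_star_a1ob`) and only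
to `a₂`, `o`, `b` (`HMF_star_a2ob`).  No hypothesis on `G − a₃`, on the weights, or on
coincidences among `a₁`, `a₂`, `o`, `b`.
-/

namespace Summit.Ventures.PercRepro2

namespace StarH

section Stars

variable {V : Type*} {E : Type*} (ends : E → Sym2 V) {f₁ f₂ f₃ f₄ : E} {a₃ a₁ a₂ : V}

/-- The star hypothesis of the extended graph with the `a₂`-coin adjoined as `none`. -/
lemma hstar_ext_a2 (hstar : ∀ e, a₃ ∈ ends e → e = f₁ ∨ e = f₃ ∨ e = f₄) :
    ∀ e, a₃ ∈ ZeroEdge.ends' ends s(a₃, a₂) e →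
      e = some f₁ ∨ e = none ∨ e = some f₃ ∨ e = some f₄ := by
  intro e he
  cases e with
  | none => exact Or.inr (Or.inl rfl)
  | some e =>
    rcases hstar e he with h | h | h
    · exact Or.inl (by rw [h])
    · exact Or.inr (Or.inr (Or.inl (by rw [h])))
    · exact Or.inr (Or.inr (Or.inr (by rw [h])))

/-- The star hypothesis of the extended graph with the `a₁`-coin adjoined as `none`. -/
lemma hstar_ext_a1 (hstar : ∀ e, a₃ ∈ ends e → e = f₂ ∨ e = f₃ ∨ e = f₄) :
    ∀ e, a₃ ∈ ZeroEdge.ends' ends s(a₃, a₁) e →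
      e = none ∨ e = some f₂ ∨ e = some f₃ ∨ e = some f₄ := by
  intro e he
  cases e with
  | none => exact Or.inl rfl
  | some e =>
    rcases hstar e he with h | h | h
    · exact Or.inr (Or.inl (by rw [h]))
    · exact Or.inr (Or.inr (Or.inl (by rw [h])))
    · exact Or.inr (Or.inr (Or.inr (by rw [h])))

end Stars

section Faces

variable {V : Type*} {E : Type*} [Fintype E] [DecidableEq E] [Fintype V] [DecidableEq V]
  {R : Type*} [Field R] [LinearOrder R] [IsStrictOrderedRing R]

variable (p : E → R) (ends : E → Sym2 V) {f₁ f₂ f₃ f₄ : E} {a₃ a₁ a₂ o b : V}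

/-- **(HMF) when `a₃` is adjacent only to `a₁`, `o` and `b`** (the `β = 0` face of the hub). -/
theorem HMF_star_a1ob (hp : IsProbVec p) (hf₁ : ends f₁ = s(a₃, a₁)) (hf₃ : ends f₃ = s(a₃, o))
    (hf₄ : ends f₄ = s(a₃, b)) (hstar : ∀ e, a₃ ∈ ends e → e = f₁ ∨ e = f₃ ∨ e = f₄)
    (h31 : a₃ ≠ a₁) (h32 : a₃ ≠ a₂) (h3o : a₃ ≠ o) (h3b : a₃ ≠ b) (h13 : f₁ ≠ f₃) (h14 : f₁ ≠ f₄)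
    (h34 : f₃ ≠ f₄) : HMF p ends o a₁ a₂ a₃ b := by
  rw [← ZeroEdge.HMF_ext_iff p ends s(a₃, a₂)]
  exact HMF_star_h (ZeroEdge.p' p) (ZeroEdge.ends' ends s(a₃, a₂)) (ZeroEdge.isProbVec_p' hp)
    (f₁ := some f₁) (f₂ := none) (f₃ := some f₃) (f₄ := some f₄) hf₁ rfl hf₃ hf₄
    (hstar_ext_a2 ends hstar) h31 h32 h3o h3b (by simp) (by simpa using h13) (by simpa using h14)
    (by simp) (by simp) (by simpa using h34)

/-- **(HMF) when `a₃` is adjacent only to `a₂`, `o` and `b`** (the `α = 0` face of the hub). -/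
theorem HMF_star_a2ob (hp : IsProbVec p) (hf₂ : ends f₂ = s(a₃, a₂)) (hf₃ : ends f₃ = s(a₃, o))
    (hf₄ : ends f₄ = s(a₃, b)) (hstar : ∀ e, a₃ ∈ ends e → e = f₂ ∨ e = f₃ ∨ e = f₄)
    (h31 : a₃ ≠ a₁) (h32 : a₃ ≠ a₂) (h3o : a₃ ≠ o) (h3b : a₃ ≠ b) (h23 : f₂ ≠ f₃) (h24 : f₂ ≠ f₄)
    (h34 : f₃ ≠ f₄) : HMF p ends o a₁ a₂ a₃ b := by
  rw [← ZeroEdge.HMF_ext_iff p ends s(a₃, a₁)]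
  exact HMF_star_h (ZeroEdge.p' p) (ZeroEdge.ends' ends s(a₃, a₁)) (ZeroEdge.isProbVec_p' hp)
    (f₁ := none) (f₂ := some f₂) (f₃ := some f₃) (f₄ := some f₄) rfl hf₂ hf₃ hf₄
    (hstar_ext_a1 ends hstar) h31 h32 h3o h3b (by simp) (by simp) (by simp)
    (by simpa using h23) (by simpa using h24) (by simpa using h34)

/-- (HCOV) for the face `{a₁, o, b}`. -/
theorem HCov_star_a1ob (hp : IsProbVec p) (hf₁ : ends f₁ = s(a₃, a₁)) (hf₃ : ends f₃ = s(a₃, o))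
    (hf₄ : ends f₄ = s(a₃, b)) (hstar : ∀ e, a₃ ∈ ends e → e = f₁ ∨ e = f₃ ∨ e = f₄)
    (h31 : a₃ ≠ a₁) (h32 : a₃ ≠ a₂) (h3o : a₃ ≠ o) (h3b : a₃ ≠ b) (h13 : f₁ ≠ f₃) (h14 : f₁ ≠ f₄)
    (h34 : f₃ ≠ f₄) : CovForm.HCov p ends o a₁ a₂ a₃ b :=
  HCov_of_HMF p hp ends o a₁ a₂ a₃ b
    (HMF_star_a1ob p ends hp hf₁ hf₃ hf₄ hstar h31 h32 h3o h3b h13 h14 h34)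

/-- (HCOV) for the face `{a₂, o, b}`. -/
theorem HCov_star_a2ob (hp : IsProbVec p) (hf₂ : ends f₂ = s(a₃, a₂)) (hf₃ : ends f₃ = s(a₃, o))
    (hf₄ : ends f₄ = s(a₃, b)) (hstar : ∀ e, a₃ ∈ ends e → e = f₂ ∨ e = f₃ ∨ e = f₄)
    (h31 : a₃ ≠ a₁) (h32 : a₃ ≠ a₂) (h3o : a₃ ≠ o) (h3b : a₃ ≠ b) (h23 : f₂ ≠ f₃) (h24 : f₂ ≠ f₄)
    (h34 : f₃ ≠ f₄) : CovForm.HCov p ends o a₁ a₂ a₃ b :=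
  HCov_of_HMF p hp ends o a₁ a₂ a₃ b
    (HMF_star_a2ob p ends hp hf₂ hf₃ hf₄ hstar h31 h32 h3o h3b h23 h24 h34)

end Faces

end StarH

end Summit.Ventures.PercRepro2
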